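import Summits.QuantumFields.YangMills.Theorems.BackwardLiouvilleRigidityOneStepBackwardContractionAdmDescentDisintegration
import HarnessLib

/-! O1-R2 «SF-trajectory currency» — TYPABILITY SKETCH ONLY (ym-r3-idea-1 g25, D25-8 repair proposal; not a line, not LEAD's text).
The extra tower-block DATA and CLAUSES that would let PATH B run on the all-levels small-field projected densities
`ρSF_k = density of descend_* (χ_{k+1} · μSF_{k+1})`, `μSF_T = μ_T` (Bałaban's trivial-history densities), kernel-free. -/

open MeasureTheory Filter Topology
open Literature.MathematicalPhysics.QuantumFieldTheory.Balaban1983to89 T3ContinuumYM3Torus T3NestedUnitLaws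
  T3UnitLawDensityEML T4Continuum BalabanUVClass T3UnitScaleTilt

namespace Summit.QuantumFields.YangMills.Cruxes.FluctuationComparisonRegPrIntL.SFTrajectorySketch

noncomputable def sfCut {P : Params} {k : ℕ} (θ : ℝ) (U : GaugeField P k ↥(Matrix.specialUnitaryGroup (Fin 2) ℂ)) : ℝ :=
  ∏ p : Plaq P k, max 0 (min 1 (3 - 4 * dist1 (GaugeField.plaqHol U p) / θ))


/-- The SF-trajectory clauses for ONE tower `(μ, ρSF)` up to height `T` with deficit budget `ηS` (to be conjoined, for both towers, to O1's
tower block; O1's 4-point currency is then stated on `log ρSF_k − log ρSF′_k`). -/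
def SFTrajectoryClauses (F : T3Family) (γ b₀ p₀ : ℝ) (T : ℕ)
    (μ : (k : ℕ) → Measure (GaugeField (F.P k) 0 ↥(Matrix.specialUnitaryGroup (Fin 2) ℂ)))
    (ρSF : (k : ℕ) → GaugeField (F.P k) 0 ↥(Matrix.specialUnitaryGroup (Fin 2) ℂ) → ℝ) (ηS : ℕ → ℝ) : Prop :=
  (∀ k V, 0 ≤ ρSF k V) ∧ (∀ k, Measurable (ρSF k)) ∧
  (fieldMeasure (F.P T) 0 ↥(Matrix.specialUnitaryGroup (Fin 2) ℂ)).withDensity (fun U => ENNReal.ofReal (ρSF T U)) = μ T ∧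
  (∀ k, k < T →
    (fieldMeasure (F.P k) 0 ↥(Matrix.specialUnitaryGroup (Fin 2) ℂ)).withDensity (fun V => ENNReal.ofReal (ρSF k V)) =
      Measure.map (descend F ℰp k)
        ((fieldMeasure (F.P (k + 1)) 0 ↥(Matrix.specialUnitaryGroup (Fin 2) ℂ)).withDensity
          (fun U => ENNReal.ofReal (sfCut (θBal F.L γ b₀ p₀ (k + 1)) U * ρSF (k + 1) U)))) ∧
  (∀ k, k ≤ T →
    μ k Set.univ ≤ (fieldMeasure (F.P k) 0 ↥(Matrix.specialUnitaryGroup (Fin 2) ℂ)).withDensity (fun V => ENNReal.ofReal (ρSF k V)) Set.univ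
      + ENNReal.ofReal (ηS k)) ∧
  (∀ k, k ≤ T → ContinuousOn (ρSF k) {V | PlaqSmall (θBal F.L γ b₀ p₀ k) V} ∧
    ∀ V, PlaqSmall (θBal F.L γ b₀ p₀ k) V → 0 < ρSF k V)

end Summit.QuantumFields.YangMills.Cruxes.FluctuationComparisonRegPrIntL.SFTrajectorySketch
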